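import Summits.QuantumAdvantage.QuantumAdvantage.Theorems.CubicForrelationNearExactIsExactTwelveLevelSixGammaH3

/-!
# Crux `CubicForrelation.NearExactIsExact` (stmt-QuantumAdvantage-14043) — n = 12 AT `Φ = 29/32`, level-6 configuration (γ):
  the RADICAL of the quadratic sign pattern on the 9-flat has exactly `8` elements (rank `6`) — every other rank is dead

Certificate seat `b2b-cforr-cert` (gen 25).  HONEST FRAMING: a finite-slice lemma (standard axioms, no `decide`) about cubic Boolean pairs on
12 bits; third brick for killing configuration (γ) of `tw23_boundary_reduction2` (plan HOME/b2b-cforr-cert-g25/PROOF-N12-928-GAMMA.md).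
It does NOT decide (γ) and claims NO value of `θ₁₂`.  NOT summit progress.

Setting (`gr_radical_eq_eight`): cubic `f, g`, `W_g = 64u''`, `W_f = 64w_f`, `Z = {u'' even} = x_Z ⊕ V₀` a 9-flat, residual
`e = u'' − (−1)^f = sZ∘hb` on `Z` (a sign), off-flat energy `Σ_{x∉Z} e² = 256` with `Σ_{x∉Z} |e| ≤ 128` (e.g. `e = ±2` on a 64-set), and the
partner's even set `Z' = {w_f even}` has `≥ 512` points (it is a non-empty cubic support: `tw23_boundary_reduction2` applied to `(g,f)`).
By `gh_H3` (5-flat sums) `hb` is quadratic along `Z` (`fr_hsd`); let `R ⊆ V₀` be the radical of its form, `#R = 2^k` (`sw_card_xorClosed`).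
The integer character sum `M(y) = Σ_{x∈Z} σ(x)(−1)^{x·y}` has `M² ∈ {0, 2^{9+k}}` (`d0_Shat_sq`, `gs_SR`) and `Σ_y M² = 2²¹` (Parseval);
the off-flat transform `ν̂ = −64e_f − M` (duality `l5k_duality`) has `|ν̂| ≤ 128` and `Σ_y ν̂² = 2²⁰`.
* `k` even: `2^{9+k}` is not a square, so `M ≡ 0` — contradicts `Σ M² = 2²¹`.
* `k = 1`: `|M| = 32` at `2048` frequencies, where `|ν̂| ≥ 32`: `Σ ν̂² ≥ 2²¹ > 2²⁰`.
* `k ≥ 5`: `128 ∣ M`, so `ν̂ = 64j`, `Σ j² = 256`, and `e_f ≡ j (mod 2)`: `#Z' = #{j odd} ≤ 256 < 512`.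
Hence `k = 3`: `#R = 8` (rank 6).  The rank-6 case is killed in the next file by a 7-flat through a non-degenerate 4-flat.

References: MacWilliams–Sloane (1977) Ch. 15 §2; R. O'Donnell (2014) §1.4.  Axioms: the standard three.
-/

set_option linter.dupNamespace false -- D-0017: single-problem summit ⇒ `QuantumAdvantage.QuantumAdvantage` by design

noncomputable section

namespace Summit.QuantumAdvantage.QuantumAdvantage.Theorems.CubicForrelation.NearExactIsExact

open Finset
open Literature.Computability.QuantumComplexity
open Literature.Computability.QuantumComplexity.BuzetChailloux (bxor zeroVec bxor_bxor_cancel_left bxor_zeroVec zeroVec_bxor bxor_comm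
  bxor_self)
open Literature.Computability.QuantumComplexity.DerivativeWalsh (W)
open Literature.Computability.QuantumComplexity.DerivativeWalsh (twist_bxor_left sum_W_sq)
open Literature.Computability.QuantumComplexity.Simon (twist_eq_one_or)

/-- **The radical has exactly `8` elements.**  See the module docstring for the setting and the three exclusions (`k` even, `k = 1`,
`k ≥ 5`). [this work] -/
theorem gr_radical_eq_eight (f g : (Fin (6 + 6) → Bool) → Bool) (hf : IsDegLeFun 3 f) (hg : IsDegLeFun 3 g)
    (u'' : (Fin (6 + 6) → Bool) → ℤ) (hu'' : ∀ x, W (fun y => signOf (g y)) x = (2 : ℝ) ^ 6 * (u'' x : ℝ))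
    (V₀ : Finset (Fin (6 + 6) → Bool)) (xZ : Fin (6 + 6) → Bool) (h0 : zeroVec ∈ V₀) (hadd : ∀ a ∈ V₀, ∀ b ∈ V₀, bxor a b ∈ V₀)
    (hcardV : #V₀ = 512) (hS : (univ.filter fun x : Fin (6 + 6) → Bool => ¬ Odd (u'' x)) = V₀.image (bxor xZ))
    (hb : (Fin (6 + 6) → Bool) → Bool)
    (hhb : ∀ x ∈ (univ.filter fun x : Fin (6 + 6) → Bool => ¬ Odd (u'' x)), sZ (hb x) = u'' x - sZ (f x))
    (hl1 : ∑ y ∈ univ.filter (fun y => y ∉ (univ.filter fun x : Fin (6 + 6) → Bool => ¬ Odd (u'' x))), |(u'' y - sZ (f y))| ≤ 128)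
    (hoff : ∑ y ∈ univ.filter (fun y => y ∉ (univ.filter fun x : Fin (6 + 6) → Bool => ¬ Odd (u'' x))), (u'' y - sZ (f y)) ^ 2 = 256)
    (wf : (Fin (6 + 6) → Bool) → ℤ) (hwf : ∀ y : Fin (6 + 6) → Bool, W (fun x => signOf (f x)) y = (2 : ℝ) ^ 6 * (wf y : ℝ))
    (hZf : 512 ≤ #(univ.filter fun y : Fin (6 + 6) → Bool => ¬ Odd (wf y))) :
    #(V₀.filter fun r => ∀ v ∈ V₀, (hb xZ ^^ hb (bxor xZ r) ^^ hb (bxor xZ v) ^^ hb (bxor (bxor xZ r) v)) = false) = 8 := by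
  classical
  set Z := (univ.filter fun x : Fin (6 + 6) → Bool => ¬ Odd (u'' x)) with hZdef
  set e : (Fin (6 + 6) → Bool) → ℤ := fun x => u'' x - sZ (f x) with hedef
  have hxZ : xZ ∈ Z := by rw [hS]; exact mem_image.2 ⟨zeroVec, h0, bxor_zeroVec xZ⟩
  have hPV : ∀ x, x ∈ Z → ∀ a ∈ V₀, bxor x a ∈ Z := fun x hx a ha => fl1_coset_vadd hadd hS hx ha
  have hVP : ∀ x, x ∈ Z → bxor xZ x ∈ V₀ := fun x hx => fl1_coset_diff hS hx
  have hsZ : ∀ x ∈ Z, sZ (hb x) = e x := hhb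
  have hcardZ : #Z = 512 := by
    rw [hS, card_image_of_injective _ (fun a b hab => by simpa [bxor_bxor_cancel_left] using congrArg (bxor xZ) hab)]
    exact hcardV
  -- (H3) for `σ = sZ ∘ hb` on `Z`, hence base-free second differences
  have H3e := gh_H3 f g hf hg u'' hu'' V₀ xZ h0 hadd hcardV hS hoff.le
  have H3σ : ∀ x, x ∈ Z → ∀ a b c : Fin (6 + 6) → Bool, a ∈ V₀ → b ∈ V₀ → c ∈ V₀ →
      (4 : ℤ) ∣ ∑ ε : Fin 3 → Bool, sZ (hb (fun j => x j ^^ decide (Odd #(univ.filter fun i => ε i && (![a, b, c] : Fin 3 → Fin (6 + 6) → Bool) i j)))) := by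
    intro x hx a b c ha hb' hc'
    have hmem : ∀ ε : Fin 3 → Bool, (fun j => x j ^^ decide (Odd #(univ.filter fun i => ε i && (![a, b, c] : Fin 3 → Fin (6 + 6) → Bool) i j))) ∈ Z :=
      fun ε => fr_mem_flatPt3 V₀ h0 (· ∈ Z) hPV hx _ (fun i => by fin_cases i <;> assumption) ε
    rw [sum_congr rfl fun ε _ => hsZ _ (hmem ε)]
    exact H3e x hx a b c ha hb' hc'
  have hsd := fr_hsd V₀ (· ∈ Z) xZ hxZ hVP hb H3σ
  set R := (V₀.filter fun r => ∀ v ∈ V₀, (hb xZ ^^ hb (bxor xZ r) ^^ hb (bxor xZ v) ^^ hb (bxor (bxor xZ r) v)) = false) with hR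
  have hRadd := fr_radical_add V₀ (· ∈ Z) xZ hb hxZ hPV hadd hsd
  have hR0 : zeroVec ∈ R := fr_radical_zero_mem V₀ xZ hb h0
  obtain ⟨k, -, hk⟩ := sw_card_xorClosed R hR0 hRadd
  -- the integer character sum `M(y)`: `M² ∈ {0, 2^{9+k}}`
  have hM : ∀ y : Fin (6 + 6) → Bool, ((∑ x ∈ Z, sZ (hb x) * sZ (decide (Odd #(univ.filter fun i => x i && y i))) : ℤ) : ℝ) =
      ∑ x ∈ Z, signOf (hb x) * twist x y := by
    intro y; push_cast
    exact sum_congr rfl fun x _ => by rw [tp_sZ_cast, tp_sZ_cast, ← vg_twist_eq_signOf]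
  have hSq : ∀ y : Fin (6 + 6) → Bool, (∑ x ∈ Z, sZ (hb x) * sZ (decide (Odd #(univ.filter fun i => x i && y i))) : ℤ) = 0 ∨
      (∑ x ∈ Z, sZ (hb x) * sZ (decide (Odd #(univ.filter fun i => x i && y i))) : ℤ) ^ 2 = 2 ^ (9 + k) := by
    intro y
    have hSq := d0_Shat_sq V₀ u'' xZ h0 hadd hcardV hS hb hsd y
    rw [← hM y] at hSq
    rcases gs_SR V₀ u'' xZ h0 hadd hS hb hsd y with h | h
    · left
      rw [h, mul_zero] at hSq
      exact_mod_cast (pow_eq_zero_iff two_ne_zero).1 hSq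
    · right
      rw [h, hk] at hSq
      push_cast at hSq
      have : (((∑ x ∈ Z, sZ (hb x) * sZ (decide (Odd #(univ.filter fun i => x i && y i))) : ℤ) ^ 2 : ℤ) : ℝ) =
          ((2 ^ (9 + k) : ℤ) : ℝ) := by
        push_cast; rw [hSq, pow_add]; norm_num
      exact_mod_cast this
  -- squares that are powers of two have even exponent
  have hsq_pow : ∀ (Mv : ℤ), Mv ^ 2 = 2 ^ (9 + k) → ∃ j, 9 + k = 2 * j ∧ Mv.natAbs = 2 ^ j := by
    intro Mv hMv
    have hnat : Mv.natAbs * Mv.natAbs = 2 ^ (9 + k) := by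
      have h1 : ((Mv.natAbs * Mv.natAbs : ℕ) : ℤ) = Mv ^ 2 := by rw [Int.natAbs_mul_self, sq]
      have h2 : ((Mv.natAbs * Mv.natAbs : ℕ) : ℤ) = ((2 ^ (9 + k) : ℕ) : ℤ) := by rw [h1, hMv]; norm_cast
      exact_mod_cast h2
    exact ktg_sq_eq_two_pow (9 + k) Mv.natAbs hnat
  -- Parseval for the sign pattern on `Z`: `Σ_y M(y)² = 4096·512`
  have hparS : ∑ y : Fin (6 + 6) → Bool, (∑ x ∈ Z, signOf (hb x) * twist x y) ^ 2 = 4096 * 512 := by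
    set S : (Fin (6 + 6) → Bool) → ℝ := fun a => if a ∈ Z then signOf (hb a) else 0 with hSdef
    have hWS : ∀ y : Fin (6 + 6) → Bool, ∑ a, S a * twist a y = ∑ x ∈ Z, signOf (hb x) * twist x y := by
      intro y
      have h1 : ∀ a, S a * twist a y = if a ∈ Z then signOf (hb a) * twist a y else 0 := by
        intro a; by_cases ha : a ∈ Z
        · simp only [S, if_pos ha]
        · simp only [S, if_neg ha, zero_mul]
      rw [sum_congr rfl fun a _ => h1 a, ← sum_filter]
      have ef : univ.filter (fun a => a ∈ Z) = Z := by ext a; simp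
      rw [ef]
    have h := sum_W_sq S
    unfold W at h
    simp_rw [hWS] at h
    rw [h]
    have hS2 : ∑ a, S a ^ 2 = 512 := by
      have h1 : ∀ a, S a ^ 2 = if a ∈ Z then (1 : ℝ) else 0 := by
        intro a; by_cases ha : a ∈ Z
        · simp only [S, if_pos ha]; cases hb a <;> simp [signOf]
        · simp only [S, if_neg ha]; simp
      rw [sum_congr rfl fun a _ => h1 a, ← sum_filter, sum_const, nsmul_eq_mul, mul_one]
      have ef : univ.filter (fun a => a ∈ Z) = Z := by ext a; simp
      rw [ef, hcardZ]; norm_num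
    rw [hS2]; norm_num
  -- duality `ê = −64 e_f` and the off-flat transform
  have hu' : ∀ x, W (fun y => signOf (g y)) x = (2 : ℝ) ^ 5 * (((2 * u'' x : ℤ)) : ℝ) := fun x => by rw [hu'' x]; push_cast; ring
  have huf : ∀ y : Fin (6 + 6) → Bool, W (fun x => signOf (f x)) y = (2 : ℝ) ^ 5 * (((2 * wf y : ℤ)) : ℝ) := fun y => by rw [hwf y]; push_cast; ring
  have hdual : ∀ y : Fin (6 + 6) → Bool, ∑ a, ((e a : ℤ) : ℝ) * twist a y = -64 * (((wf y - sZ (g y) : ℤ)) : ℝ) := by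
    intro y
    have h := l5k_duality f g (fun x => 2 * u'' x) hu' (fun y => 2 * wf y) huf y
    have e2 : ∑ a, (((2 * u'' a - 2 * sZ (f a) : ℤ)) : ℝ) * twist a y = 2 * ∑ a, ((e a : ℤ) : ℝ) * twist a y := by
      rw [mul_sum]; exact sum_congr rfl fun a _ => by simp only [e]; push_cast; ring
    rw [e2] at h
    have : ∑ a, ((e a : ℤ) : ℝ) * twist a y = -32 * (((2 * wf y - 2 * sZ (g y) : ℤ)) : ℝ) := by linarith
    rw [this]; push_cast; ring
  set ν : (Fin (6 + 6) → Bool) → ℝ := fun x => if x ∉ Z then ((e x : ℤ) : ℝ) else 0 with hνdef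
  have hsplit : ∀ y : Fin (6 + 6) → Bool, ∑ a, ((e a : ℤ) : ℝ) * twist a y = (∑ x ∈ Z, signOf (hb x) * twist x y) + ∑ a, ν a * twist a y := by
    intro y
    have h1 : ∀ a, ((e a : ℤ) : ℝ) * twist a y = (if a ∈ Z then ((e a : ℤ) : ℝ) * twist a y else 0) + ν a * twist a y := by
      intro a; by_cases ha : a ∈ Z
      · simp only [ν, if_pos ha, if_neg (not_not.2 ha)]; ring
      · simp only [ν, if_neg ha, if_pos ha]; ring
    rw [sum_congr rfl fun a _ => h1 a, sum_add_distrib, ← sum_filter]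
    congr 1
    have ef : univ.filter (fun a => a ∈ Z) = Z := by ext a; simp
    rw [ef]
    exact sum_congr rfl fun x hx => by rw [← hsZ x hx, tp_sZ_cast]
  -- `ν̂ = −64e_f − M`
  have hN : ∀ y : Fin (6 + 6) → Bool, ∑ a, ν a * twist a y =
      -64 * (((wf y - sZ (g y) : ℤ)) : ℝ) - ((∑ x ∈ Z, sZ (hb x) * sZ (decide (Odd #(univ.filter fun i => x i && y i))) : ℤ) : ℝ) := by
    intro y
    have h1 := hsplit y
    rw [hdual y, ← hM y] at h1
    linarith
  have hνbound : ∀ y : Fin (6 + 6) → Bool, |∑ a, ν a * twist a y| ≤ 128 := by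
    intro y
    have hl1R : ∑ x ∈ univ.filter (fun x => x ∉ Z), |((e x : ℤ) : ℝ)| ≤ 128 := by
      have : ((∑ x ∈ univ.filter (fun x => x ∉ Z), |e x| : ℤ) : ℝ) ≤ 128 := by exact_mod_cast hl1
      push_cast at this; exact this
    calc |∑ a, ν a * twist a y| ≤ ∑ a, |ν a * twist a y| := abs_sum_le_sum_abs _ _
      _ = ∑ a, |ν a| := sum_congr rfl fun a _ => by
          rw [abs_mul]; rcases twist_eq_one_or a y with h | h <;> rw [h] <;> simp
      _ = ∑ x ∈ univ.filter (fun x => x ∉ Z), |((e x : ℤ) : ℝ)| := by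
          rw [sum_filter]; exact sum_congr rfl fun a _ => by simp only [ν]; split_ifs <;> simp
      _ ≤ 128 := hl1R
  have hparν : ∑ y, (∑ a, ν a * twist a y) ^ 2 = 4096 * 256 := by
    have h := sum_W_sq ν
    unfold W at h
    rw [h]
    have : ∑ a, ν a ^ 2 = 256 := by
      have h1 : ∑ a, ν a ^ 2 = ∑ x ∈ univ.filter (fun x => x ∉ Z), ((e x : ℤ) : ℝ) ^ 2 := by
        rw [sum_filter]; exact sum_congr rfl fun a _ => by simp only [ν]; split_ifs <;> simp
      rw [h1]; exact_mod_cast hoff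
    rw [this]; norm_num
  -- CASE `k` even: `M ≡ 0`, contradicting Parseval
  have caseB : ¬ Even k := by
    rintro ⟨k', hk'⟩
    have hzero : ∀ y : Fin (6 + 6) → Bool, (∑ x ∈ Z, sZ (hb x) * sZ (decide (Odd #(univ.filter fun i => x i && y i))) : ℤ) = 0 := by
      intro y
      rcases hSq y with h | h
      · exact h
      · exfalso
        obtain ⟨j, hj, -⟩ := hsq_pow _ h
        omega
    have : ∑ y : Fin (6 + 6) → Bool, (∑ x ∈ Z, signOf (hb x) * twist x y) ^ 2 = 0 :=
      sum_eq_zero fun y _ => by rw [← hM y, hzero y]; simp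
    rw [hparS] at this
    norm_num at this
  -- CASE `k = 1`: `|M| = 32` at `2048` frequencies, where `|ν̂| ≥ 32`
  have caseC : k ≠ 1 := by
    intro hk1
    have hsq' : ∀ y : Fin (6 + 6) → Bool, (∑ x ∈ Z, sZ (hb x) * sZ (decide (Odd #(univ.filter fun i => x i && y i))) : ℤ) = 0 ∨
        ((∑ x ∈ Z, sZ (hb x) * sZ (decide (Odd #(univ.filter fun i => x i && y i))) : ℤ) = 32 ∨
         (∑ x ∈ Z, sZ (hb x) * sZ (decide (Odd #(univ.filter fun i => x i && y i))) : ℤ) = -32) := by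
      intro y
      rcases hSq y with h | h
      · exact Or.inl h
      · right
        rw [hk1] at h
        have h' : ((∑ x ∈ Z, sZ (hb x) * sZ (decide (Odd #(univ.filter fun i => x i && y i))) : ℤ)) ^ 2 = 1024 := by
          rw [h]; norm_num
        have : ((∑ x ∈ Z, sZ (hb x) * sZ (decide (Odd #(univ.filter fun i => x i && y i))) : ℤ) - 32) *
            ((∑ x ∈ Z, sZ (hb x) * sZ (decide (Odd #(univ.filter fun i => x i && y i))) : ℤ) + 32) = 0 := by
          linear_combination h'
        rcases mul_eq_zero.1 this with h' | h'
        · left; linarith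
        · right; linarith
    set P := univ.filter (fun y : Fin (6 + 6) → Bool =>
      (∑ x ∈ Z, sZ (hb x) * sZ (decide (Odd #(univ.filter fun i => x i && y i))) : ℤ) ≠ 0) with hPdef
    have hcount : (#P : ℝ) = 2048 := by
      have h1 : ∀ y : Fin (6 + 6) → Bool, (∑ x ∈ Z, signOf (hb x) * twist x y) ^ 2 =
          if (∑ x ∈ Z, sZ (hb x) * sZ (decide (Odd #(univ.filter fun i => x i && y i))) : ℤ) ≠ 0 then (1024 : ℝ) else 0 := by
        intro y
        rw [← hM y]
        rcases hsq' y with h | h | h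
        · rw [h, if_neg (not_not.2 rfl)]; simp
        · rw [if_pos (by rw [h]; norm_num), h]; norm_num
        · rw [if_pos (by rw [h]; norm_num), h]; norm_num
      have h2 := hparS
      rw [sum_congr rfl fun y _ => h1 y, ← sum_filter, sum_const, nsmul_eq_mul] at h2
      linarith
    have hNbig : ∀ y ∈ P, (1024 : ℝ) ≤ (∑ a, ν a * twist a y) ^ 2 := by
      intro y hy
      have hne := (mem_filter.1 hy).2
      rw [hN y]
      have hodd : ∀ s : ℤ, s = 32 ∨ s = -32 → (1024 : ℝ) ≤ (-64 * (((wf y - sZ (g y) : ℤ)) : ℝ) - ((s : ℤ) : ℝ)) ^ 2 := by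
        intro s hs
        rcases hs with h | h
        · have h0 : 2 * (wf y - sZ (g y)) + 1 ≠ 0 := by omega
          have h1 : (1 : ℤ) ≤ (2 * (wf y - sZ (g y)) + 1) ^ 2 := (one_le_sq_iff_one_le_abs _).2 (Int.one_le_abs h0)
          have h1R : (1 : ℝ) ≤ (((2 * (wf y - sZ (g y)) + 1 : ℤ)) : ℝ) ^ 2 := by exact_mod_cast h1
          rw [h]; push_cast at h1R ⊢; nlinarith
        · have h0 : 2 * (wf y - sZ (g y)) - 1 ≠ 0 := by omega
          have h1 : (1 : ℤ) ≤ (2 * (wf y - sZ (g y)) - 1) ^ 2 := (one_le_sq_iff_one_le_abs _).2 (Int.one_le_abs h0)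
          have h1R : (1 : ℝ) ≤ (((2 * (wf y - sZ (g y)) - 1 : ℤ)) : ℝ) ^ 2 := by exact_mod_cast h1
          rw [h]; push_cast at h1R ⊢; nlinarith
      rcases hsq' y with h | h | h
      · exact absurd h hne
      · exact hodd _ (Or.inl h)
      · exact hodd _ (Or.inr h)
    have hlow : (1024 : ℝ) * 2048 ≤ ∑ y, (∑ a, ν a * twist a y) ^ 2 := by
      calc (1024 : ℝ) * 2048 = ∑ y ∈ P, (1024 : ℝ) := by rw [sum_const, nsmul_eq_mul, hcount]; ring
        _ ≤ ∑ y ∈ P, (∑ a, ν a * twist a y) ^ 2 := sum_le_sum hNbig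
        _ ≤ ∑ y, (∑ a, ν a * twist a y) ^ 2 := sum_le_sum_of_subset_of_nonneg (subset_univ _) fun _ _ _ => sq_nonneg _
    rw [hparν] at hlow
    norm_num at hlow
  -- CASE `k ≥ 5`: `128 ∣ M`, `ν̂ = 64j`, `Σ j² = 256`, `#Z' ≤ 256`
  have caseA : ¬ 5 ≤ k := by
    intro hk5
    have h128 : ∀ y : Fin (6 + 6) → Bool, (128 : ℤ) ∣ (∑ x ∈ Z, sZ (hb x) * sZ (decide (Odd #(univ.filter fun i => x i && y i))) : ℤ) := by
      intro y
      rcases hSq y with h | h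
      · rw [h]; exact dvd_zero _
      · obtain ⟨j, hj, hMj⟩ := hsq_pow _ h
        have hj7 : 7 ≤ j := by omega
        have hdvd : (2 ^ 7 : ℕ) ∣ (∑ x ∈ Z, sZ (hb x) * sZ (decide (Odd #(univ.filter fun i => x i && y i))) : ℤ).natAbs := by
          rw [hMj]; exact pow_dvd_pow 2 hj7
        have : ((2 ^ 7 : ℕ) : ℤ) ∣ (∑ x ∈ Z, sZ (hb x) * sZ (decide (Odd #(univ.filter fun i => x i && y i))) : ℤ) :=
          Int.natAbs_dvd_natAbs.1 (by simpa using hdvd)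
        rwa [show ((2 ^ 7 : ℕ) : ℤ) = 128 by norm_num] at this
    choose m hm using h128
    set jf : (Fin (6 + 6) → Bool) → ℤ := fun y => -(wf y - sZ (g y)) - 2 * m y with hjf
    have hj : ∀ y : Fin (6 + 6) → Bool, ∑ a, ν a * twist a y = 64 * ((jf y : ℤ) : ℝ) := by
      intro y
      rw [hN y, hm y]
      simp only [jf]; push_cast; ring
    have hj2 : ∀ y : Fin (6 + 6) → Bool, |jf y| ≤ 2 := by
      intro y
      have hb' := hνbound y
      rw [hj y, abs_mul] at hb'
      norm_num at hb'
      have h'' : ((|jf y| : ℤ) : ℝ) ≤ 2 := by push_cast; linarith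
      exact_mod_cast h''
    have hsumj : ∑ y, ((jf y : ℤ) : ℝ) ^ 2 = 256 := by
      have h1 := hparν
      rw [sum_congr rfl fun y _ => by rw [hj y]] at h1
      have : ∑ y, (64 * ((jf y : ℤ) : ℝ)) ^ 2 = 4096 * ∑ y, ((jf y : ℤ) : ℝ) ^ 2 := by
        rw [mul_sum]; exact sum_congr rfl fun y _ => by ring
      rw [this] at h1
      linarith
    -- the partner's even set is contained in `{j odd}`
    have hsub : (univ.filter fun y : Fin (6 + 6) → Bool => ¬ Odd (wf y)) ⊆ univ.filter (fun y => Odd (jf y)) := by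
      intro y hy
      have hev : ¬ Odd (wf y) := (mem_filter.1 hy).2
      refine mem_filter.2 ⟨mem_univ _, ?_⟩
      have hwf : wf y = sZ (g y) - jf y - 2 * m y := by simp only [jf]; ring
      rw [Int.odd_iff]
      rw [Int.not_odd_iff_even, Int.even_iff, hwf] at hev
      rcases tp_sZ_cases (g y) with hs | hs <;> rw [hs] at hev <;> omega
    have hcard_le : (#(univ.filter fun y : Fin (6 + 6) → Bool => Odd (jf y)) : ℝ) ≤ 256 := by
      have h1 : ∀ y : Fin (6 + 6) → Bool, (if Odd (jf y) then (1 : ℝ) else 0) ≤ ((jf y : ℤ) : ℝ) ^ 2 := by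
        intro y
        split_ifs with hodd
        · have h0 : jf y ≠ 0 := by rintro h0; rw [h0] at hodd; exact absurd hodd (by decide)
          have h1 : (1 : ℤ) ≤ jf y ^ 2 := (one_le_sq_iff_one_le_abs _).2 (Int.one_le_abs h0)
          exact_mod_cast h1
        · positivity
      have h2 : (#(univ.filter fun y : Fin (6 + 6) → Bool => Odd (jf y)) : ℝ) = ∑ y, (if Odd (jf y) then (1 : ℝ) else 0) := by
        rw [← sum_filter, sum_const, nsmul_eq_mul, mul_one]
      rw [h2, ← hsumj]
      exact sum_le_sum fun y _ => h1 y
    have h3 : #(univ.filter fun y : Fin (6 + 6) → Bool => ¬ Odd (wf y)) ≤ #(univ.filter fun y : Fin (6 + 6) → Bool => Odd (jf y)) :=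
      card_le_card hsub
    have h4 : (512 : ℝ) ≤ #(univ.filter fun y : Fin (6 + 6) → Bool => Odd (jf y)) := by
      have : ((512 : ℕ) : ℝ) ≤ ((#(univ.filter fun y : Fin (6 + 6) → Bool => Odd (jf y)) : ℕ) : ℝ) := by
        exact_mod_cast hZf.trans h3
      simpa using this
    linarith
  -- hence `k = 3`
  have hk3 : k = 3 := by
    rcases Nat.even_or_odd k with hev | ⟨k', hk'⟩
    · exact absurd hev caseB
    · omega
  rw [hk, hk3]; norm_num

end Summit.QuantumAdvantage.QuantumAdvantage.Theorems.CubicForrelation.NearExactIsExact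

end
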